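import Literature.Topology.FourManifolds.TautFoliationsGridLines
import Literature.Topology.FourManifolds.TautFoliationsEdgeChart
import HarnessLib

/-!
# Open edges of a square grid and the diamonds of the edge charts

Topic: sequel to `TautFoliationsGridLines.lean` and `TautFoliationsEdgeChart.lean`: the
combinatorial geometry needed to assemble the contour charts of a disc in checkerboard cone
position.

* `Grid.rightNb q q'` / `Grid.topNb q q'` (**definitions**): `q'` is the right / top neighbour
  of `q`; the centres differ by `(2ℓ, 0)` / `(0, 2ℓ)` (`centre_rightNb`, `centre_topNb`);
* `Grid.openRightEdge q`, `Grid.openTopEdge q` (**definitions**) and their basic properties: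
  they lie on the boundaries of `q` and of the neighbour, miss every open small square
  (`openRightEdge_disjoint_ball`, …), miss the centres and the vertices, determine `q`
  (`eq_of_mem_openRightEdge`), and a right-edge point is not a top-edge point;
* `ball_disjoint_sq` (**proved**): the open square of `q₁` misses the closed square of `q ≠ q₁`;
* `edgeDiamond_subset` (**proved**): the diamond of the right edge of `q` lies in
  `ball (centre q) ℓ ∪ ball (centre q') ℓ ∪ openRightEdge q`.

All statements are [folklore].
-/

noncomputable section

open Set Metric

namespace Literature.Topology.FourManifolds

namespace SquareGrid

namespace Grid

variable (g : Grid) {x : ℝ × ℝ} {q q' q₁ : Fin g.n × Fin g.n}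

/-! ## Edge-neighbours -/

/-- `q'` is the right neighbour of `q`. [folklore] -/
def rightNb (q q' : Fin g.n × Fin g.n) : Prop := (q'.1 : ℕ) = q.1 + 1 ∧ q'.2 = q.2

/-- `q'` is the top neighbour of `q`. [folklore] -/
def topNb (q q' : Fin g.n × Fin g.n) : Prop := q'.1 = q.1 ∧ (q'.2 : ℕ) = q.2 + 1

/-- The centre of the right neighbour. [folklore] -/
theorem centre_rightNb (h : g.rightNb q q') : g.centre q' = ((g.centre q).1 + 2 * g.ℓ, (g.centre q).2) := by
  obtain ⟨h1, h2⟩ := h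
  ext
  · rw [centre_fst, centre_fst, h1]; push_cast; ring
  · rw [centre_snd, centre_snd, h2]

/-- The centre of the top neighbour. [folklore] -/
theorem centre_topNb (h : g.topNb q q') : g.centre q' = ((g.centre q).1, (g.centre q).2 + 2 * g.ℓ) := by
  obtain ⟨h1, h2⟩ := h
  ext
  · rw [centre_fst, centre_fst, h1]
  · rw [centre_snd, centre_snd, h2]; push_cast; ring

/-- A square with `q.1 + 1 < n` has a right neighbour. [folklore] -/
theorem exists_rightNb (hq : (q.1 : ℕ) + 1 < g.n) : ∃ q', g.rightNb q q' :=
  ⟨(⟨q.1 + 1, hq⟩, q.2), rfl, rfl⟩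

/-- A square with `q.2 + 1 < n` has a top neighbour. [folklore] -/
theorem exists_topNb (hq : (q.2 : ℕ) + 1 < g.n) : ∃ q', g.topNb q q' :=
  ⟨(q.1, ⟨q.2 + 1, hq⟩), rfl, rfl⟩

/-- Right neighbours are distinct squares. [folklore] -/
theorem ne_of_rightNb (h : g.rightNb q q') : q ≠ q' := by
  rintro rfl; exact absurd h.1 (by omega)

/-- Top neighbours are distinct squares. [folklore] -/
theorem ne_of_topNb (h : g.topNb q q') : q ≠ q' := by
  rintro rfl; exact absurd h.2 (by omega)

/-! ## Open squares are disjoint from the other closed squares -/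

/-- **The open square of `q₁` misses the closed square of every other index.** [folklore] -/
theorem ball_disjoint_sq (hne : q₁ ≠ q) : Disjoint (ball (g.centre q₁) g.ℓ) (g.sq q) := by
  rw [disjoint_left]
  intro y hy hyq
  have hs := g.mem_sphere_of_mem_sq_of_ne hne (ball_subset_closedBall hy) hyq
  rw [mem_sphere] at hs
  rw [mem_ball] at hy
  exact absurd hs (ne_of_lt hy)

/-! ## Open edges -/

/-- The open right edge of `q`. [folklore] -/
def openRightEdge (q : Fin g.n × Fin g.n) : Set (ℝ × ℝ) :=
  {y | y.1 = (g.centre q).1 + g.ℓ ∧ |y.2 - (g.centre q).2| < g.ℓ}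

/-- The open top edge of `q`. [folklore] -/
def openTopEdge (q : Fin g.n × Fin g.n) : Set (ℝ × ℝ) :=
  {y | y.2 = (g.centre q).2 + g.ℓ ∧ |y.1 - (g.centre q).1| < g.ℓ}

/-- The open right edge lies on the boundary of `q`. [folklore] -/
theorem openRightEdge_subset_sphere : g.openRightEdge q ⊆ sphere (g.centre q) g.ℓ := by
  rintro y ⟨h1, h2⟩
  rw [mem_sphere, Prod.dist_eq, Real.dist_eq, Real.dist_eq, h1, show (g.centre q).1 + g.ℓ - (g.centre q).1 = g.ℓ by ring,
    abs_of_pos g.hℓ]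
  exact max_eq_left h2.le

/-- The open right edge lies on the boundary of the right neighbour. [folklore] -/
theorem openRightEdge_subset_sphere' (h : g.rightNb q q') : g.openRightEdge q ⊆ sphere (g.centre q') g.ℓ := by
  rintro y ⟨h1, h2⟩
  rw [mem_sphere, Prod.dist_eq, Real.dist_eq, Real.dist_eq, g.centre_rightNb h, h1]
  simp only
  rw [show (g.centre q).1 + g.ℓ - ((g.centre q).1 + 2 * g.ℓ) = -g.ℓ by ring, abs_neg, abs_of_pos g.hℓ]
  exact max_eq_left h2.le

/-- The open top edge lies on the boundary of `q`. [folklore] -/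
theorem openTopEdge_subset_sphere : g.openTopEdge q ⊆ sphere (g.centre q) g.ℓ := by
  rintro y ⟨h1, h2⟩
  rw [mem_sphere, Prod.dist_eq, Real.dist_eq, Real.dist_eq, h1, show (g.centre q).2 + g.ℓ - (g.centre q).2 = g.ℓ by ring,
    abs_of_pos g.hℓ]
  exact max_eq_right h2.le

/-- The open top edge lies on the boundary of the top neighbour. [folklore] -/
theorem openTopEdge_subset_sphere' (h : g.topNb q q') : g.openTopEdge q ⊆ sphere (g.centre q') g.ℓ := by
  rintro y ⟨h1, h2⟩
  rw [mem_sphere, Prod.dist_eq, Real.dist_eq, Real.dist_eq, g.centre_topNb h, h1]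
  simp only
  rw [show (g.centre q).2 + g.ℓ - ((g.centre q).2 + 2 * g.ℓ) = -g.ℓ by ring, abs_neg, abs_of_pos g.hℓ]
  exact max_eq_right h2.le

/-- **Open edges miss every open small square.** [folklore] -/
theorem openRightEdge_disjoint_ball (q q₁ : Fin g.n × Fin g.n) : Disjoint (g.openRightEdge q) (ball (g.centre q₁) g.ℓ) := by
  rw [disjoint_left]
  intro y hy hyb
  by_cases h : q₁ = q
  · subst h
    have := g.openRightEdge_subset_sphere hy
    rw [mem_sphere] at this; rw [mem_ball] at hyb; exact absurd this (ne_of_lt hyb)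
  · exact disjoint_left.1 (g.ball_disjoint_sq h) hyb (g.sphere_subset_sq q (g.openRightEdge_subset_sphere hy))

/-- Open top edges miss every open small square. [folklore] -/
theorem openTopEdge_disjoint_ball (q q₁ : Fin g.n × Fin g.n) : Disjoint (g.openTopEdge q) (ball (g.centre q₁) g.ℓ) := by
  rw [disjoint_left]
  intro y hy hyb
  by_cases h : q₁ = q
  · subst h
    have := g.openTopEdge_subset_sphere hy
    rw [mem_sphere] at this; rw [mem_ball] at hyb; exact absurd this (ne_of_lt hyb)
  · exact disjoint_left.1 (g.ball_disjoint_sq h) hyb (g.sphere_subset_sq q (g.openTopEdge_subset_sphere hy))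

/-- Integrality: `|2 k ℓ| < 2 ℓ` for an integer `k` forces `k = 0`. [folklore] -/
theorem int_eq_zero_of_abs_lt {k : ℤ} (h : |2 * (k : ℝ) * g.ℓ| < 2 * g.ℓ) : k = 0 := by
  have hℓ := g.hℓ
  rw [abs_lt] at h
  have h1 : (k : ℝ) < 1 := by nlinarith [h.2]
  have h2 : (-1 : ℝ) < k := by nlinarith [h.1]
  have h1' : k < 1 := by exact_mod_cast h1
  have h2' : -1 < k := by exact_mod_cast h2
  omega

/-- **The open right edge determines the square.** [folklore] -/
theorem eq_of_mem_openRightEdge {y : ℝ × ℝ} (h : y ∈ g.openRightEdge q) (h₁ : y ∈ g.openRightEdge q₁) : q = q₁ := by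
  obtain ⟨ha, hb⟩ := h
  obtain ⟨ha₁, hb₁⟩ := h₁
  have hℓ := g.hℓ
  rw [centre_fst] at ha ha₁
  rw [centre_snd] at hb hb₁
  have e1 : (q.1 : ℕ) = q₁.1 := by
    have : (2 * (q.1 : ℕ) + 1 : ℝ) * g.ℓ = (2 * (q₁.1 : ℕ) + 1) * g.ℓ := by linarith
    have := mul_right_cancel₀ hℓ.ne' this
    exact_mod_cast (by linarith : ((q.1 : ℕ) : ℝ) = q₁.1)
  have e2 : (q.2 : ℕ) = q₁.2 := by
    have hlt : |2 * (((q.2 : ℕ) : ℤ) - ((q₁.2 : ℕ) : ℤ) : ℝ) * g.ℓ| < 2 * g.ℓ := by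
      have : 2 * (((q.2 : ℕ) : ℤ) - ((q₁.2 : ℕ) : ℤ) : ℝ) * g.ℓ =
          (y.2 - (g.a.2 + (2 * (q₁.2 : ℕ) + 1) * g.ℓ)) - (y.2 - (g.a.2 + (2 * (q.2 : ℕ) + 1) * g.ℓ)) := by
        push_cast; ring
      rw [this]
      calc |(y.2 - (g.a.2 + (2 * (q₁.2 : ℕ) + 1) * g.ℓ)) - (y.2 - (g.a.2 + (2 * (q.2 : ℕ) + 1) * g.ℓ))|
          ≤ |y.2 - (g.a.2 + (2 * (q₁.2 : ℕ) + 1) * g.ℓ)| + |y.2 - (g.a.2 + (2 * (q.2 : ℕ) + 1) * g.ℓ)| := abs_sub _ _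
        _ < g.ℓ + g.ℓ := add_lt_add hb₁ hb
        _ = 2 * g.ℓ := by ring
    have := g.int_eq_zero_of_abs_lt (k := ((q.2 : ℕ) : ℤ) - ((q₁.2 : ℕ) : ℤ)) (by push_cast at hlt ⊢; exact hlt)
    omega
  exact Prod.ext (Fin.ext e1) (Fin.ext e2)

/-- The open top edge determines the square. [folklore] -/
theorem eq_of_mem_openTopEdge {y : ℝ × ℝ} (h : y ∈ g.openTopEdge q) (h₁ : y ∈ g.openTopEdge q₁) : q = q₁ := by
  obtain ⟨ha, hb⟩ := h
  obtain ⟨ha₁, hb₁⟩ := h₁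
  have hℓ := g.hℓ
  rw [centre_snd] at ha ha₁
  rw [centre_fst] at hb hb₁
  have e2 : (q.2 : ℕ) = q₁.2 := by
    have : (2 * (q.2 : ℕ) + 1 : ℝ) * g.ℓ = (2 * (q₁.2 : ℕ) + 1) * g.ℓ := by linarith
    have := mul_right_cancel₀ hℓ.ne' this
    exact_mod_cast (by linarith : ((q.2 : ℕ) : ℝ) = q₁.2)
  have e1 : (q.1 : ℕ) = q₁.1 := by
    have hlt : |2 * (((q.1 : ℕ) : ℤ) - ((q₁.1 : ℕ) : ℤ) : ℝ) * g.ℓ| < 2 * g.ℓ := by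
      have : 2 * (((q.1 : ℕ) : ℤ) - ((q₁.1 : ℕ) : ℤ) : ℝ) * g.ℓ =
          (y.1 - (g.a.1 + (2 * (q₁.1 : ℕ) + 1) * g.ℓ)) - (y.1 - (g.a.1 + (2 * (q.1 : ℕ) + 1) * g.ℓ)) := by
        push_cast; ring
      rw [this]
      calc |(y.1 - (g.a.1 + (2 * (q₁.1 : ℕ) + 1) * g.ℓ)) - (y.1 - (g.a.1 + (2 * (q.1 : ℕ) + 1) * g.ℓ))|
          ≤ |y.1 - (g.a.1 + (2 * (q₁.1 : ℕ) + 1) * g.ℓ)| + |y.1 - (g.a.1 + (2 * (q.1 : ℕ) + 1) * g.ℓ)| := abs_sub _ _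
        _ < g.ℓ + g.ℓ := add_lt_add hb₁ hb
        _ = 2 * g.ℓ := by ring
    have := g.int_eq_zero_of_abs_lt (k := ((q.1 : ℕ) : ℤ) - ((q₁.1 : ℕ) : ℤ)) (by push_cast at hlt ⊢; exact hlt)
    omega
  exact Prod.ext (Fin.ext e1) (Fin.ext e2)

/-- **A right-edge point is not a top-edge point.** [folklore] -/
theorem openRightEdge_disjoint_openTopEdge (q q₁ : Fin g.n × Fin g.n) : Disjoint (g.openRightEdge q) (g.openTopEdge q₁) := by
  rw [disjoint_left]
  rintro y ⟨ha, -⟩ ⟨-, hb₁⟩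
  have hℓ := g.hℓ
  rw [centre_fst] at ha hb₁
  rw [ha] at hb₁
  -- `|(2 q.1 + 2) ℓ - (2 q₁.1 + 1) ℓ| < ℓ`: an odd multiple of `ℓ` of absolute value `< ℓ`, absurd
  have : |(2 * ((q.1 : ℕ) : ℝ) - 2 * ((q₁.1 : ℕ) : ℝ) + 1) * g.ℓ| < g.ℓ := by
    have h := hb₁
    rw [show g.a.1 + (2 * ((q.1 : ℕ) : ℝ) + 1) * g.ℓ + g.ℓ - (g.a.1 + (2 * ((q₁.1 : ℕ) : ℝ) + 1) * g.ℓ) =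
      (2 * ((q.1 : ℕ) : ℝ) - 2 * ((q₁.1 : ℕ) : ℝ) + 1) * g.ℓ by ring] at h
    exact h
  rw [abs_mul, abs_of_pos hℓ] at this
  have h2 : |2 * ((q.1 : ℕ) : ℝ) - 2 * ((q₁.1 : ℕ) : ℝ) + 1| < 1 := by
    by_contra hge; push Not at hge; nlinarith
  -- but `2 (q.1 - q₁.1) + 1` is an odd integer
  have hint : ∃ k : ℤ, (2 * ((q.1 : ℕ) : ℝ) - 2 * ((q₁.1 : ℕ) : ℝ) + 1) = (2 * k + 1 : ℤ) :=
    ⟨(q.1 : ℕ) - (q₁.1 : ℕ), by push_cast; ring⟩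
  obtain ⟨k, hk⟩ := hint
  rw [hk, ← Int.cast_abs] at h2
  have h3 : |2 * k + 1| < 1 := by exact_mod_cast h2
  rw [abs_lt] at h3
  omega

/-- Open right edges miss the centres. [folklore] -/
theorem openRightEdge_disjoint_centres (q : Fin g.n × Fin g.n) : Disjoint (g.openRightEdge q) g.centres := by
  rw [disjoint_left]
  rintro y hy ⟨q₁, rfl⟩
  exact disjoint_left.1 (g.openRightEdge_disjoint_ball q q₁) hy (mem_ball_self g.hℓ)

/-- Open top edges miss the centres. [folklore] -/
theorem openTopEdge_disjoint_centres (q : Fin g.n × Fin g.n) : Disjoint (g.openTopEdge q) g.centres := by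
  rw [disjoint_left]
  rintro y hy ⟨q₁, rfl⟩
  exact disjoint_left.1 (g.openTopEdge_disjoint_ball q q₁) hy (mem_ball_self g.hℓ)

/-- Open right edges miss the vertices. [folklore] -/
theorem openRightEdge_disjoint_vertices (q : Fin g.n × Fin g.n) : Disjoint (g.openRightEdge q) g.vertices := by
  rw [disjoint_left]
  rintro y ⟨-, hb⟩ ⟨p, -, rfl⟩
  have hℓ := g.hℓ
  simp only at hb
  rw [centre_snd] at hb
  -- `|2 p.2 ℓ - (2 q.2 + 1) ℓ| < ℓ`: absurd as above
  have : |(2 * ((p.2 : ℕ) : ℝ) - 2 * ((q.2 : ℕ) : ℝ) - 1) * g.ℓ| < g.ℓ := by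
    rw [show g.a.2 + 2 * ((p.2 : ℕ) : ℝ) * g.ℓ - (g.a.2 + (2 * ((q.2 : ℕ) : ℝ) + 1) * g.ℓ) =
      (2 * ((p.2 : ℕ) : ℝ) - 2 * ((q.2 : ℕ) : ℝ) - 1) * g.ℓ by ring] at hb
    exact hb
  rw [abs_mul, abs_of_pos hℓ] at this
  have h2 : |2 * ((p.2 : ℕ) : ℝ) - 2 * ((q.2 : ℕ) : ℝ) - 1| < 1 := by
    by_contra hge; push Not at hge; nlinarith
  have hint : ∃ k : ℤ, (2 * ((p.2 : ℕ) : ℝ) - 2 * ((q.2 : ℕ) : ℝ) - 1) = (2 * k + 1 : ℤ) :=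
    ⟨(p.2 : ℕ) - (q.2 : ℕ) - 1, by push_cast; ring⟩
  obtain ⟨k, hk⟩ := hint
  rw [hk, ← Int.cast_abs] at h2
  have h3 : |2 * k + 1| < 1 := by exact_mod_cast h2
  rw [abs_lt] at h3
  omega

/-- Open top edges miss the vertices. [folklore] -/
theorem openTopEdge_disjoint_vertices (q : Fin g.n × Fin g.n) : Disjoint (g.openTopEdge q) g.vertices := by
  rw [disjoint_left]
  rintro y ⟨-, hb⟩ ⟨p, -, rfl⟩
  have hℓ := g.hℓ
  simp only at hb
  rw [centre_fst] at hb
  have : |(2 * ((p.1 : ℕ) : ℝ) - 2 * ((q.1 : ℕ) : ℝ) - 1) * g.ℓ| < g.ℓ := by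
    rw [show g.a.1 + 2 * ((p.1 : ℕ) : ℝ) * g.ℓ - (g.a.1 + (2 * ((q.1 : ℕ) : ℝ) + 1) * g.ℓ) =
      (2 * ((p.1 : ℕ) : ℝ) - 2 * ((q.1 : ℕ) : ℝ) - 1) * g.ℓ by ring] at hb
    exact hb
  rw [abs_mul, abs_of_pos hℓ] at this
  have h2 : |2 * ((p.1 : ℕ) : ℝ) - 2 * ((q.1 : ℕ) : ℝ) - 1| < 1 := by
    by_contra hge; push Not at hge; nlinarith
  have hint : ∃ k : ℤ, (2 * ((p.1 : ℕ) : ℝ) - 2 * ((q.1 : ℕ) : ℝ) - 1) = (2 * k + 1 : ℤ) :=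
    ⟨(p.1 : ℕ) - (q.1 : ℕ) - 1, by push_cast; ring⟩
  obtain ⟨k, hk⟩ := hint
  rw [hk, ← Int.cast_abs] at h2
  have h3 : |2 * k + 1| < 1 := by exact_mod_cast h2
  rw [abs_lt] at h3
  omega

/-! ## The diamond of the right edge -/

/-- **The diamond of the right edge of `q` lies in the two open squares and the open edge.**
[folklore] -/
theorem edgeDiamond_subset (h : g.rightNb q q') :
    ConeSquare.edgeDiamond (g.centre q) g.ℓ ⊆ ball (g.centre q) g.ℓ ∪ ball (g.centre q') g.ℓ ∪ g.openRightEdge q := by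
  intro y hy
  have hℓ := g.hℓ
  rcases lt_trichotomy y.1 ((g.centre q).1 + g.ℓ) with hlt | heq | hgt
  · obtain ⟨hdist, -, -, -, -, -⟩ := ConeSquare.left_fan hℓ hy hlt.le
    left; left
    rw [mem_ball, hdist]; linarith
  · right
    have h0 : |y.2 - (g.centre q).2| < min (y.1 - (g.centre q).1) ((g.centre q).1 + 2 * g.ℓ - y.1) := hy
    refine ⟨heq, ?_⟩
    have := lt_of_lt_of_le h0 (min_le_left _ _)
    rw [heq] at this; linarith [this]
  · obtain ⟨hdist, -, -, -, -, -⟩ := ConeSquare.right_fan hℓ hy hgt.le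
    left; right
    rw [mem_ball, g.centre_rightNb h]
    rw [ConeSquare.rightCenter] at hdist
    rw [hdist]; linarith

end Grid

end SquareGrid

end Literature.Topology.FourManifolds
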